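import Summits.QuantumFields.YangMills.Theorems.UnitScaleTiltProp7PinnedBiharmonicAgmonWindow
import Summits.QuantumFields.YangMills.Theorems.UnitScaleTiltProp7TorusAgmonWeight
import Summits.QuantumFields.YangMills.Theorems.UnitScaleTiltProp7TorusExpWeightSum
import Summits.QuantumFields.YangMills.Theorems.UnitScaleTiltProp7CentrePinnedHessianPoincare
import HarnessLib

/-!
# Route `UnitScaleTilt`, crux K1 «MinimiserStabilityRegPr» (stmt-QuantumFields-19200), route-R E′ path (α′), (E1-b), row (hK₂-W) — FILE 1 (E-loc):
# THE LOCAL LAPLACIAN ENERGY OF THE PINNED-BIHARMONIC INTERPOLATION ERROR — `Σ_{tdist(z,x₀) ≤ R} (Δ(φ − φ_H)(z))² ≤ C_E·e^{R∕ℓ}·ℓ³·(sup|Δφ|)²`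
# AT EVERY BASE POINT `x₀`, FROM (D2′) AGMON WITH THE RECIPROCAL (DECAYING) WEIGHT

Cell `ym3-torus`, width seat `ym3-torus-px7` (gen 3), LOCATE 19200 evidence `LOCATE-HK2W-HARMONIC-px7g3.md` §2 (E-loc); ★p1 g15's standing PASS for the
(E1-a…e) lineages (21:15:16Z).  `--supports stmt-QuantumFields-19200`, count-neutral.  THEOREMS ONLY (0 `def`, 0 `sorry`).  YM₃ on T³ is a ladder rung (R3),
not the Clay problem; nothing here claims the stub, the crux, d = 4 or the gap.

THE POINT.  The dist-weighted Laplacian row (hK₂-W) `ℓ·min(tdist(x,C),ℓ)·|Δ(φ − φ_H)(x)| ≤ c₂′·ℓ²·sup|Δφ|` of the (E1) contraction scheme (★routeR-w3 g5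
LOCATE-E1 §3 row 3, px4 g2's pin-cone restatement) is proved WITHOUT kernels: `Δ(φ − φ_H) = Δφ − V` with `V := Δφ_H` lattice-harmonic off the centres, so
`V` is controlled pointwise by its LOCAL `ℓ²` mass (flat interior mean value) — and that mass is this file: (D2′) ✓ `weighted_laplace_le_window` holds for
ANY positive weight with small relative first∕second differences, in particular for the RECIPROCAL `ω = 1∕w` of the growing Agmon weight ✓
`exists_admissible_weight (x₀)`; `ω` decays like `exp(−2κ·tdist(·,x₀)∕(π√d·ℓ))`, so `Σ(ωΔφ)² ≤ sup|Δφ|²·Σω² ≲ ℓ^d·sup|Δφ|²` (✓ `sum_exp_neg_tdist_div_le`),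
while `ω ≥ e^{−κ(1+R∕ℓ)}` on the ball `{tdist(·,x₀) ≤ R}`.

WHAT IS PROVED (ns `…Theorems.Prop7InterpErrorLocalLaplaceEnergy`; torus `T^{(j)}`, lattice factor `c`, centre set `C`, real site fields).
* §1 `inv_rows_of_rows` — if `w > 0` has relative rows `(a, b)` with `a ≤ 1∕2` then `1∕w` has relative rows `(2a, 4b + 8a²)`.
* §2 ★★ `sum_ball_sq_laplace_interp_error_le` — abstract `C`, the pinned Poincaré row in root form (constant `A`) and the two ℓ-free window rows
  DISPLAYED (the currency of ✓ `weighted_laplace_le_window`): `Σ_{tdist(z,x₀)≤R}(Δ(φ−φ_H)(z))² ≤ 9·e^{2κ(1+R∕ℓ)}·(2 + π√d·ℓ∕(2κ))^d·M²` whenever `|Δφ| ≤ M`.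
* §3 ★★★ `sum_ball_sq_laplace_interp_error_le_T3` — `P.d = 3`, `j = 0`, `C = range (embIter k)`, (D1-glob) DISCHARGED by ✓
  `Prop7CentrePinnedHessianPoincare.sum_sq_le_laplace_sq_of_vanish_on_range`, one absolute `κ₀ = 1∕(3000√C_G)` chosen inside:
  `∃ C_E > 0, ∀ … , Σ_{tdist(z,x₀)≤R}(Δ(φ−φ_H)(z))² ≤ C_E·e^{R∕L^k}·(L^k)³·M²` — `C_E` depends on nothing (not on `c`, `L`, `k`, the volume).
HONEST SCOPE.  Flat letters; the harmonic-function steps (BULK)(Q)(PIN)(ASM) of (hK₂-W) are FILE 2.  Nothing of [Balaban1984PropagatorsII] is asserted beyond the cited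
shape «exponential decay of constrained propagators at the block scale» ((1.9) p.226), of which this is the two-sided (decaying-weight) reading.

References: T. Bałaban, CMP 96 (1984) 223–250 [Balaban1984PropagatorsII] ((1.9) p.226); CMP 99 (1985) 75–102 [Balaban1985RegularSpaces] ((1.36) p.82);
CMP 102 (1985) 277–309 [Balaban1985Variational] (Prop. 7 p.299); S. Agmon, Princeton Math. Notes 29 (1982) (method).
-/

set_option autoImplicit false

noncomputable section

open scoped BigOperators

namespace Summit.QuantumFields.YangMills.Theorems.Prop7InterpErrorLocalLaplaceEnergy

open Literature.MathematicalPhysics.QuantumFieldTheory.Balaban1983to89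
open Finset LatticeFieldCalculus
open B15DeterminingSets (embIter)
open Summit.QuantumFields.YangMills.Theorems.Prop7PinnedBiharmonicAgmonDecay (el_of_biharmonic_off poincare_root_of_sq)
open Summit.QuantumFields.YangMills.Theorems.Prop7PinnedBiharmonicAgmonWindow (weighted_laplace_le_window)
open Summit.QuantumFields.YangMills.Theorems.Prop7TorusAgmonWeight (exists_admissible_weight)
open Summit.QuantumFields.YangMills.Theorems.Prop7TorusExpWeightSum (sum_exp_neg_tdist_div_le)
open Summit.QuantumFields.YangMills.Theorems.Prop7CentrePinnedHessianPoincare (sum_sq_le_laplace_sq_of_vanish_on_range)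

variable {P : Params} {j : ℕ}

/-! ## §1 The reciprocal of an admissible weight is admissible -/

/-- one value: `0 < w, 0 < w'`, `|w' − w| ≤ a·w`, `a ≤ 1∕2` ⇒ `|w'⁻¹ − w⁻¹| ≤ 2a·w⁻¹` (since `w' ≥ w∕2`). [folklore] -/
theorem abs_inv_sub_inv_le {w w' a : ℝ} (hw : 0 < w) (hw' : 0 < w') (ha : a ≤ 1 / 2) (h : |w' - w| ≤ a * w) :
    |w'⁻¹ - w⁻¹| ≤ (2 * a) * w⁻¹ := by
  have hlow : w / 2 ≤ w' := by
    have := (abs_sub_le_iff.1 h).2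
    nlinarith
  have e : w'⁻¹ - w⁻¹ = (w - w') / (w' * w) := by
    field_simp
  rw [e, abs_div, abs_of_pos (mul_pos hw' hw), div_le_iff₀ (mul_pos hw' hw), abs_sub_comm]
  calc |w' - w| ≤ a * w := h
    _ ≤ 2 * a * w⁻¹ * (w' * w) := by
        rw [show 2 * a * w⁻¹ * (w' * w) = 2 * a * w' * (w⁻¹ * w) by ring, inv_mul_cancel₀ hw.ne', mul_one]
        have ha0 : 0 ≤ a := by
          have := abs_nonneg (w' - w)
          nlinarith
        nlinarith

/-- one value, second difference: `|w₊ + w₋ − 2w| ≤ b·w` and the two first-difference rows give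
`|w₊⁻¹ + w₋⁻¹ − 2w⁻¹| ≤ (4b + 8a²)·w⁻¹` (numerator `−w(δ₊+δ₋) − 2δ₊δ₋`, denominator `≥ w³∕4`). [folklore] -/
theorem abs_inv_add_inv_sub_le {w wp wm a b : ℝ} (hw : 0 < w) (hwp : 0 < wp) (hwm : 0 < wm) (ha : a ≤ 1 / 2)
    (hp : |wp - w| ≤ a * w) (hm : |wm - w| ≤ a * w) (h2 : |wp + wm - 2 * w| ≤ b * w) :
    |wp⁻¹ + wm⁻¹ - 2 * w⁻¹| ≤ (4 * b + 8 * a ^ 2) * w⁻¹ := by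
  have hlp : w / 2 ≤ wp := by have := (abs_sub_le_iff.1 hp).2; nlinarith
  have hlm : w / 2 ≤ wm := by have := (abs_sub_le_iff.1 hm).2; nlinarith
  have ha0 : 0 ≤ a := by have := abs_nonneg (wp - w); nlinarith
  have hb0 : 0 ≤ b := by have := abs_nonneg (wp + wm - 2 * w); nlinarith
  have e : wp⁻¹ + wm⁻¹ - 2 * w⁻¹ = (-(w * ((wp - w) + (wm - w))) - 2 * ((wp - w) * (wm - w))) / (w * wp * wm) := by
    field_simp
    ring
  have hden : 0 < w * wp * wm := by positivity
  rw [e, abs_div, abs_of_pos hden, div_le_iff₀ hden]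
  have hnum : |(-(w * ((wp - w) + (wm - w))) - 2 * ((wp - w) * (wm - w)))| ≤ w * (b * w) + 2 * ((a * w) * (a * w)) := by
    refine (abs_sub _ _).trans (add_le_add ?_ ?_)
    · rw [abs_neg, abs_mul, abs_of_pos hw]
      refine mul_le_mul_of_nonneg_left ?_ hw.le
      have : (wp - w) + (wm - w) = wp + wm - 2 * w := by ring
      rw [this]; exact h2
    · rw [abs_mul, abs_mul, abs_two]
      exact mul_le_mul_of_nonneg_left (mul_le_mul hp hm (abs_nonneg _) (by positivity)) (by norm_num)
  refine hnum.trans ?_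
  rw [show (4 * b + 8 * a ^ 2) * w⁻¹ * (w * wp * wm) = (4 * b + 8 * a ^ 2) * (wp * wm) * (w⁻¹ * w) by ring,
    inv_mul_cancel₀ hw.ne', mul_one]
  have hprod : w * w / 4 ≤ wp * wm := by nlinarith
  have hcoef : 0 ≤ 4 * b + 8 * a ^ 2 := by positivity
  nlinarith [mul_nonneg hcoef (sub_nonneg.2 hprod)]

/-- §1 **THE RECIPROCAL WEIGHT**: if `w > 0` has the (D2′) relative rows `(a, b)` with `a ≤ 1∕2`, then `ω := w⁻¹` is positive with relative rows
`(2a, 4b + 8a²)`.  (So the Agmon estimate ✓ `weighted_laplace_le_window`, stated for ANY such weight, localises AT a point as well as AWAY from one.) [folklore] -/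
theorem inv_rows_of_rows (w : SiteField P j ℝ) {a b : ℝ} (ha : a ≤ 1 / 2)
    (hw₀ : ∀ x, 0 < w x)
    (hw₁ : ∀ x μ, |w (x.shift μ) - w x| ≤ a * w x ∧ |w (x.unshift μ) - w x| ≤ a * w x)
    (hw₂ : ∀ x μ, |w (x.shift μ) + w (x.unshift μ) - 2 * w x| ≤ b * w x) :
    (∀ x, 0 < (w x)⁻¹) ∧
      (∀ x μ, |(w (x.shift μ))⁻¹ - (w x)⁻¹| ≤ (2 * a) * (w x)⁻¹ ∧ |(w (x.unshift μ))⁻¹ - (w x)⁻¹| ≤ (2 * a) * (w x)⁻¹) ∧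
      (∀ x μ, |(w (x.shift μ))⁻¹ + (w (x.unshift μ))⁻¹ - 2 * (w x)⁻¹| ≤ (4 * b + 8 * a ^ 2) * (w x)⁻¹) := by
  refine ⟨fun x => inv_pos.2 (hw₀ x), fun x μ => ⟨?_, ?_⟩, fun x μ => ?_⟩
  · exact abs_inv_sub_inv_le (hw₀ x) (hw₀ _) ha (hw₁ x μ).1
  · exact abs_inv_sub_inv_le (hw₀ x) (hw₀ _) ha (hw₁ x μ).2
  · exact abs_inv_add_inv_sub_le (hw₀ x) (hw₀ _) (hw₀ _) ha (hw₁ x μ).1 (hw₁ x μ).2 (hw₂ x μ)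

/-! ## §2 ★★ The local Laplacian energy of the interpolation error — abstract centre set, (D1-glob) and the window displayed -/

/-- ★★ **LOCAL LAPLACIAN ENERGY OF THE INTERPOLATION ERROR (abstract form).**  Torus `T^{(j)}`, lattice factor `c`, centre set `C`; base point `x₀`,
scale `ℓ ≥ 1`, rate `0 < κ ≤ 1∕8`; the pinned Poincaré row in root form (constant `A ≥ 0`) and the two ℓ-free window rows `(4κ∕ℓ)|c|√d·√A ≤ 1∕100`,
`((16κ + 32κ²)∕ℓ²)·c²d·A ≤ 1∕50` DISPLAYED; `φ_H` a pinned interpolant of `φ|_C` biharmonic off `C`; `|Δφ| ≤ M`.  Then for every radius `R`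
`Σ_{tdist(z,x₀) ≤ R} (Δ(φ − φ_H)(z))² ≤ 9·e^{2κ(1+R∕ℓ)}·(2 + π√d·ℓ∕(2κ))^d·M²`
((D2′) ✓ `weighted_laplace_le_window` at the reciprocal of ✓ `exists_admissible_weight (x₀)`, the count ✓ `sum_exp_neg_tdist_div_le`, and
`ω ≥ e^{−κ(1+R∕ℓ)}` on the ball). [cite: Balaban1984PropagatorsII, (1.9) p.226; Balaban1985Variational, Prop. 7 p.299] -/
theorem sum_ball_sq_laplace_interp_error_le (c : ℝ) (C : Set (Site P j)) (x₀ : Site P j) {ℓ κ A R M : ℝ}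
    (hℓ : 1 ≤ ℓ) (hκ0 : 0 < κ) (hκ1 : κ ≤ 1 / 8) (hA : 0 ≤ A)
    (hP : ∀ v : SiteField P j ℝ, (∀ y ∈ C, v y = 0) →
      Real.sqrt (∑ x, v x ^ 2) ≤ A * Real.sqrt (∑ x, laplace c v x ^ 2))
    (hwin₁ : 4 * κ / ℓ * |c| * Real.sqrt P.d * Real.sqrt A ≤ 1 / 100)
    (hwin₂ : (16 * κ + 32 * κ ^ 2) / ℓ ^ 2 * c ^ 2 * P.d * A ≤ 1 / 50)
    (φ φH : SiteField P j ℝ) (hH : ∀ x ∈ C, φH x = φ x) (hEL : ∀ x ∉ C, laplace c (laplace c φH) x = 0)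
    (hφ : ∀ z, |laplace c φ z| ≤ M) :
    ∑ z ∈ Finset.univ.filter (fun z : Site P j => (Site.tdist z x₀ : ℝ) ≤ R), (laplace c (fun x => φ x - φH x) z) ^ 2
      ≤ 9 * Real.exp (2 * κ * (1 + R / ℓ)) * (2 + Real.pi * Real.sqrt P.d * ℓ / (2 * κ)) ^ P.d * M ^ 2 := by
  classical
  have hℓ0 : 0 < ℓ := by linarith
  have hπ := Real.pi_pos
  have hd0 : 0 < (P.d : ℝ) := by exact_mod_cast Nat.lt_of_lt_of_le Nat.zero_lt_one P.hd
  have hsd : 0 < Real.sqrt P.d := Real.sqrt_pos.mpr hd0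
  have hM : 0 ≤ M := (abs_nonneg _).trans (hφ x₀)
  -- the growing weight at base `x₀` and its reciprocal
  obtain ⟨w, hw₀, hw₁, hw₂, hlo, hhi⟩ := exists_admissible_weight x₀ hℓ hκ0.le (by linarith : κ ≤ 1)
  have ha : 2 * κ / ℓ ≤ 1 / 2 := by
    rw [div_le_iff₀ hℓ0]; nlinarith
  obtain ⟨hω₀, hω₁, hω₂⟩ := inv_rows_of_rows w ha hw₀ hw₁ hw₂
  set ω : SiteField P j ℝ := fun x => (w x)⁻¹ with hωdef
  have ea : 2 * (2 * κ / ℓ) = 4 * κ / ℓ := by ring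
  have eb : 4 * (4 * κ / ℓ ^ 2) + 8 * (2 * κ / ℓ) ^ 2 = (16 * κ + 32 * κ ^ 2) / ℓ ^ 2 := by
    field_simp
    ring
  have hω₁' : ∀ x μ, |ω (x.shift μ) - ω x| ≤ (4 * κ / ℓ) * ω x ∧ |ω (x.unshift μ) - ω x| ≤ (4 * κ / ℓ) * ω x := by
    intro x μ; rw [← ea]; exact hω₁ x μ
  have hω₂' : ∀ x μ, |ω (x.shift μ) + ω (x.unshift μ) - 2 * ω x| ≤ ((16 * κ + 32 * κ ^ 2) / ℓ ^ 2) * ω x := by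
    intro x μ; rw [← eb]; exact hω₂ x μ
  have ha' : 4 * κ / ℓ ≤ 1 / 2 := by rw [div_le_iff₀ hℓ0]; nlinarith
  -- the interpolation error is pinned and satisfies the type-1 EL identity
  have he : ∀ y ∈ C, (fun x => φ x - φH x) y = 0 := fun y hy => by simp [hH y hy]
  have hEL' := el_of_biharmonic_off c C φ φH hEL
  have hwl := (weighted_laplace_le_window c C ω (fun x => φ x - φH x) (laplace c φ) (fun _ => (0 : ℝ)) (fun _ => (0 : ℝ))
    (by positivity) (by positivity) hA hω₀ hω₁' hω₂' hP he hEL' ha' hwin₁ hwin₂).1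
  simp only [mul_zero, ne_eq, OfNat.ofNat_ne_zero, not_false_eq_true, zero_pow, Finset.sum_const_zero,
    Real.sqrt_zero, add_zero] at hwl
  -- square it: `Σ(ωΔe)² ≤ 9·Σ(ωΔφ)²`
  set E : ℝ := ∑ x, (ω x * laplace c (fun x => φ x - φH x) x) ^ 2 with hE
  set F : ℝ := ∑ x, (ω x * laplace c φ x) ^ 2 with hF
  have hE0 : 0 ≤ E := Finset.sum_nonneg fun _ _ => sq_nonneg _
  have hF0 : 0 ≤ F := Finset.sum_nonneg fun _ _ => sq_nonneg _
  have hEF : E ≤ 9 * F := by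
    have h1 : Real.sqrt E ^ 2 ≤ (3 * Real.sqrt F) ^ 2 := pow_le_pow_left₀ (Real.sqrt_nonneg _) hwl 2
    rw [Real.sq_sqrt hE0, mul_pow, Real.sq_sqrt hF0] at h1
    linarith
  -- the weighted size of the datum: `Σ(ωΔφ)² ≤ M²·Σω² ≤ M²·(2 + π√dℓ∕(2κ))^d`
  set a' : ℝ := 2 * κ / (Real.pi * Real.sqrt P.d) with ha'def
  have ha'0 : 0 < a' := by rw [ha'def]; positivity
  have hcount : ∑ x : Site P j, ω x ^ 2 ≤ (2 + Real.pi * Real.sqrt P.d * ℓ / (2 * κ)) ^ P.d := by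
    have hs := sum_exp_neg_tdist_div_le x₀ ha'0 hℓ0
    have e2 : ℓ / a' = Real.pi * Real.sqrt P.d * ℓ / (2 * κ) := by
      rw [ha'def]; field_simp
    rw [e2] at hs
    refine le_trans (Finset.sum_le_sum fun z _ => ?_) hs
    -- `ω² ≤ e^{−(2a'∕ℓ)·tdist}`
    have hz := hlo z
    have e1 : Real.exp (-(2 * a' / ℓ * (Site.tdist z x₀ : ℝ)))
        = (Real.exp (2 * κ / (Real.pi * Real.sqrt P.d * ℓ) * (Site.tdist z x₀ : ℝ)) ^ 2)⁻¹ := by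
      rw [← Real.exp_nat_mul, ← Real.exp_neg, ha'def]
      congr 1
      field_simp
      ring
    rw [e1, hωdef]
    dsimp only
    rw [inv_pow]
    exact inv_anti₀ (by positivity) (pow_le_pow_left₀ (Real.exp_pos _).le hz 2)
  have hFM : F ≤ M ^ 2 * (2 + Real.pi * Real.sqrt P.d * ℓ / (2 * κ)) ^ P.d := by
    calc F = ∑ x, ω x ^ 2 * (laplace c φ x) ^ 2 := by rw [hF]; exact Finset.sum_congr rfl fun x _ => by ring
      _ ≤ ∑ x, ω x ^ 2 * M ^ 2 := Finset.sum_le_sum fun x _ =>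
          mul_le_mul_of_nonneg_left (by have := hφ x; nlinarith [abs_nonneg (laplace c φ x), sq_abs (laplace c φ x)]) (sq_nonneg _)
      _ = M ^ 2 * ∑ x, ω x ^ 2 := by rw [← Finset.sum_mul]; ring
      _ ≤ M ^ 2 * (2 + Real.pi * Real.sqrt P.d * ℓ / (2 * κ)) ^ P.d := mul_le_mul_of_nonneg_left hcount (sq_nonneg _)
  -- on the ball the weight is at least `e^{−κ(1+R∕ℓ)}`
  have hball : ∀ z ∈ Finset.univ.filter (fun z : Site P j => (Site.tdist z x₀ : ℝ) ≤ R),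
      (laplace c (fun x => φ x - φH x) z) ^ 2
        ≤ Real.exp (2 * κ * (1 + R / ℓ)) * (ω z * laplace c (fun x => φ x - φH x) z) ^ 2 := by
    intro z hz
    rw [Finset.mem_filter] at hz
    have hwz : w z ≤ Real.exp (κ * (1 + R / ℓ)) := by
      refine (hhi z).trans (Real.exp_le_exp.mpr ?_)
      have : (Site.tdist z x₀ : ℝ) / ℓ ≤ R / ℓ := div_le_div_of_nonneg_right hz.2 hℓ0.le
      nlinarith
    have hωz : Real.exp (-(κ * (1 + R / ℓ))) ≤ ω z := by
      rw [hωdef]; dsimp only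
      rw [Real.exp_neg]
      exact inv_anti₀ (hw₀ z) hwz
    have hωz0 : 0 ≤ Real.exp (-(κ * (1 + R / ℓ))) := (Real.exp_pos _).le
    set q := laplace c (fun x => φ x - φH x) z
    calc q ^ 2 = Real.exp (2 * κ * (1 + R / ℓ)) * (Real.exp (-(κ * (1 + R / ℓ))) * q) ^ 2 := by
          rw [mul_pow, ← Real.exp_nat_mul, ← mul_assoc, ← Real.exp_add]
          have : 2 * κ * (1 + R / ℓ) + ((2 : ℕ) : ℝ) * -(κ * (1 + R / ℓ)) = 0 := by push_cast; ring
          rw [this, Real.exp_zero, one_mul]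
      _ ≤ Real.exp (2 * κ * (1 + R / ℓ)) * (ω z * q) ^ 2 := by
          refine mul_le_mul_of_nonneg_left ?_ (Real.exp_pos _).le
          rw [mul_pow, mul_pow]
          exact mul_le_mul_of_nonneg_right (pow_le_pow_left₀ hωz0 hωz 2) (sq_nonneg _)
  calc ∑ z ∈ Finset.univ.filter (fun z : Site P j => (Site.tdist z x₀ : ℝ) ≤ R), (laplace c (fun x => φ x - φH x) z) ^ 2
      ≤ ∑ z ∈ Finset.univ.filter (fun z : Site P j => (Site.tdist z x₀ : ℝ) ≤ R),
          Real.exp (2 * κ * (1 + R / ℓ)) * (ω z * laplace c (fun x => φ x - φH x) z) ^ 2 := Finset.sum_le_sum hball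
    _ = Real.exp (2 * κ * (1 + R / ℓ)) * ∑ z ∈ Finset.univ.filter (fun z : Site P j => (Site.tdist z x₀ : ℝ) ≤ R),
          (ω z * laplace c (fun x => φ x - φH x) z) ^ 2 := by rw [Finset.mul_sum]
    _ ≤ Real.exp (2 * κ * (1 + R / ℓ)) * E := by
        refine mul_le_mul_of_nonneg_left ?_ (Real.exp_pos _).le
        exact Finset.sum_le_sum_of_subset_of_nonneg (Finset.filter_subset _ _) fun _ _ _ => sq_nonneg _
    _ ≤ Real.exp (2 * κ * (1 + R / ℓ)) * (9 * (M ^ 2 * (2 + Real.pi * Real.sqrt P.d * ℓ / (2 * κ)) ^ P.d)) := by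
        refine mul_le_mul_of_nonneg_left (hEF.trans ?_) (Real.exp_pos _).le
        linarith
    _ = 9 * Real.exp (2 * κ * (1 + R / ℓ)) * (2 + Real.pi * Real.sqrt P.d * ℓ / (2 * κ)) ^ P.d * M ^ 2 := by ring

/-! ## §3 ★★★ The record's finest torus: `d = 3`, `C = range (embIter k)`, (D1-glob) discharged, one absolute rate -/

/-- ★★★ **LOCAL LAPLACIAN ENERGY OF THE INTERPOLATION ERROR ON `T³`, ALL CONSTANTS ABSOLUTE.**  There is `C_E > 0` such that for every record with
`P.d = 3`, every `k ≤ m + K`, lattice factor `c ≠ 0`, base point `x₀`, radius `R ≥ 0`, every `φ` and every pinned interpolant `φ_H` of `φ` on the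
`k`-centres (`φ_H(embIter k y) = φ(embIter k y)`) biharmonic off them (`Δ²φ_H = 0` off `range (embIter k)`), and every bound `|Δφ| ≤ M`:
`Σ_{tdist(z,x₀) ≤ R} (Δ(φ − φ_H)(z))² ≤ C_E·e^{R∕L^k}·(L^k)³·M²`.
(§2 with the pinned `H²`-Poincaré (D1-glob) ✓ `sum_sq_le_laplace_sq_of_vanish_on_range` — `A = √(C_G∕c⁴)·(L^k)²` — and the rate `κ₀ = 1∕(3000√C_G)`,
for which both window rows hold identically in `c`, `L`, `k`; `C_E = 9e·(2 + π√3∕(2κ₀))³`.) [cite: Balaban1984PropagatorsII, (1.9) p.226; Balaban1985RegularSpaces, (1.36) p.82] -/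
theorem sum_ball_sq_laplace_interp_error_le_T3 : ∃ CE : ℝ, 0 < CE ∧
    ∀ (P : Params) (_ : P.d = 3) (k : ℕ) (_ : k ≤ P.m + P.K) (c : ℝ) (_ : c ≠ 0) (x₀ : Site P 0) (R : ℝ) (_ : 0 ≤ R)
      (φ φH : SiteField P 0 ℝ) (_ : ∀ x ∈ Set.range (embIter k), φH x = φ x)
      (_ : ∀ x ∉ Set.range (embIter k), laplace c (laplace c φH) x = 0) (M : ℝ) (_ : ∀ z, |laplace c φ z| ≤ M),
      ∑ z ∈ Finset.univ.filter (fun z : Site P 0 => (Site.tdist z x₀ : ℝ) ≤ R), (laplace c (fun x => φ x - φH x) z) ^ 2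
        ≤ CE * Real.exp (R / (P.L : ℝ) ^ k) * ((P.L : ℝ) ^ k) ^ 3 * M ^ 2 := by
  set CG : ℝ := (2197 * (24 * 289 * 24576 * 46116) : ℝ) with hCG
  have hCG1 : 1 ≤ CG := by rw [hCG]; norm_num
  have hsCG1 : 1 ≤ Real.sqrt CG := by rw [Real.le_sqrt (by norm_num) (by linarith)]; linarith
  have hsCG0 : 0 < Real.sqrt CG := by linarith
  set κ₀ : ℝ := 1 / (3000 * Real.sqrt CG) with hκ₀
  have hκ₀0 : 0 < κ₀ := by rw [hκ₀]; positivity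
  have hκ₀s : κ₀ * Real.sqrt CG = 1 / 3000 := by rw [hκ₀]; field_simp
  have hκ₀1 : κ₀ ≤ 1 / 3000 := by
    rw [hκ₀]
    exact one_div_le_one_div_of_le (by norm_num) (by linarith : (3000 : ℝ) ≤ 3000 * Real.sqrt CG)
  have hκ₀8 : κ₀ ≤ 1 / 8 := hκ₀1.trans (by norm_num)
  set CE : ℝ := 9 * Real.exp 1 * (2 + Real.pi * Real.sqrt 3 / (2 * κ₀)) ^ 3 with hCE
  refine ⟨CE, by rw [hCE]; positivity, ?_⟩
  intro P hd k hk c hc x₀ R hR φ φH hH hEL M hφ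
  classical
  have hπ := Real.pi_pos
  have hL1 : (1 : ℝ) ≤ (P.L : ℝ) := by exact_mod_cast P.L_pos
  set ℓ : ℝ := (P.L : ℝ) ^ k with hℓdef
  have hℓ : 1 ≤ ℓ := one_le_pow₀ hL1
  have hℓ0 : 0 < ℓ := by linarith
  have hc2 : 0 < c ^ 2 := by positivity
  have hc4 : 0 < c ^ 4 := by positivity
  -- (D1-glob) in root form with `A = √(C_G∕c⁴)·ℓ²`
  have hP0 := sum_sq_le_laplace_sq_of_vanish_on_range (P := P) hd hk hc
  have hCP : 0 ≤ CG / c ^ 4 := by positivity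
  have hP : ∀ v : SiteField P 0 ℝ, (∀ y ∈ Set.range (embIter k), v y = 0) →
      Real.sqrt (∑ x, v x ^ 2) ≤ (Real.sqrt (CG / c ^ 4) * ℓ ^ 2) * Real.sqrt (∑ x, laplace c v x ^ 2) :=
    poincare_root_of_sq c (Set.range (embIter k)) hCP (fun v hv => by
      have := hP0 v hv; rw [hCG]; exact this)
  set A : ℝ := Real.sqrt (CG / c ^ 4) * ℓ ^ 2 with hAdef
  have hA : 0 ≤ A := by positivity
  -- `A = √C_G·ℓ²∕c²`
  have hsq4 : Real.sqrt (c ^ 4) = c ^ 2 := by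
    rw [show c ^ 4 = (c ^ 2) ^ 2 by ring, Real.sqrt_sq hc2.le]
  have hAe : A = Real.sqrt CG * ℓ ^ 2 / c ^ 2 := by
    rw [hAdef, Real.sqrt_div (by linarith), hsq4]; ring
  -- window 1: square it — `(4κ₀∕ℓ·|c|·√3·√A)² = 48κ₀²√C_G ≤ 10⁻⁴`
  have hd3 : (P.d : ℝ) = 3 := by exact_mod_cast hd
  have hwin₁ : 4 * κ₀ / ℓ * |c| * Real.sqrt P.d * Real.sqrt A ≤ 1 / 100 := by
    have hx0 : 0 ≤ 4 * κ₀ / ℓ * |c| * Real.sqrt P.d * Real.sqrt A := by positivity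
    have hsq : (4 * κ₀ / ℓ * |c| * Real.sqrt P.d * Real.sqrt A) ^ 2 = 48 * κ₀ ^ 2 * Real.sqrt CG := by
      rw [mul_pow, mul_pow, mul_pow, Real.sq_sqrt hA, Real.sq_sqrt (by positivity), sq_abs, hd3, hAe]
      field_simp
      ring
    have hle : (4 * κ₀ / ℓ * |c| * Real.sqrt P.d * Real.sqrt A) ^ 2 ≤ (1 / 100) ^ 2 := by
      rw [hsq, show 48 * κ₀ ^ 2 * Real.sqrt CG = 48 * κ₀ * (κ₀ * Real.sqrt CG) by ring, hκ₀s]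
      linarith
    exact (pow_le_pow_iff_left₀ hx0 (by norm_num) two_ne_zero).1 hle
  -- window 2: `((16κ₀ + 32κ₀²)∕ℓ²)·c²·3·A = (48κ₀ + 96κ₀²)·√C_G ≤ 1∕50`
  have hwin₂ : (16 * κ₀ + 32 * κ₀ ^ 2) / ℓ ^ 2 * c ^ 2 * P.d * A ≤ 1 / 50 := by
    have e : (16 * κ₀ + 32 * κ₀ ^ 2) / ℓ ^ 2 * c ^ 2 * P.d * A = 48 * (κ₀ * Real.sqrt CG) + 96 * κ₀ * (κ₀ * Real.sqrt CG) := by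
      rw [hd3, hAe]; field_simp; ring
    rw [e, hκ₀s]
    linarith
  -- §2 at `κ₀`
  have hd3' : Real.sqrt (P.d : ℝ) = Real.sqrt 3 := by rw [hd3]
  have h2 := sum_ball_sq_laplace_interp_error_le c (Set.range (embIter k)) x₀ (R := R) hℓ hκ₀0 hκ₀8 hA hP hwin₁ hwin₂ φ φH hH hEL hφ
  rw [hd3', hd] at h2
  refine h2.trans ?_
  -- constants: `e^{2κ₀(1+R∕ℓ)} ≤ e·e^{R∕ℓ}`, `(2 + π√3ℓ∕(2κ₀))³ ≤ (2 + π√3∕(2κ₀))³·ℓ³`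
  have hM2 : 0 ≤ M ^ 2 := sq_nonneg _
  have hexp : Real.exp (2 * κ₀ * (1 + R / ℓ)) ≤ Real.exp 1 * Real.exp (R / ℓ) := by
    rw [← Real.exp_add]
    refine Real.exp_le_exp.mpr ?_
    have hR' : 0 ≤ 1 + R / ℓ := by positivity
    calc 2 * κ₀ * (1 + R / ℓ) ≤ 1 * (1 + R / ℓ) := mul_le_mul_of_nonneg_right (by linarith) hR'
      _ = 1 + R / ℓ := one_mul _
  have hpow : (2 + Real.pi * Real.sqrt 3 * ℓ / (2 * κ₀)) ^ 3 ≤ (2 + Real.pi * Real.sqrt 3 / (2 * κ₀)) ^ 3 * ℓ ^ 3 := by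
    rw [← mul_pow]
    refine pow_le_pow_left₀ (by positivity) ?_ 3
    rw [add_mul]
    have : Real.pi * Real.sqrt 3 * ℓ / (2 * κ₀) = Real.pi * Real.sqrt 3 / (2 * κ₀) * ℓ := by ring
    rw [this]
    linarith
  have hXY : Real.exp (2 * κ₀ * (1 + R / ℓ)) * (2 + Real.pi * Real.sqrt 3 * ℓ / (2 * κ₀)) ^ 3
      ≤ (Real.exp 1 * Real.exp (R / ℓ)) * ((2 + Real.pi * Real.sqrt 3 / (2 * κ₀)) ^ 3 * ℓ ^ 3) :=
    mul_le_mul hexp hpow (by positivity) (by positivity)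
  calc 9 * Real.exp (2 * κ₀ * (1 + R / ℓ)) * (2 + Real.pi * Real.sqrt 3 * ℓ / (2 * κ₀)) ^ 3 * M ^ 2
      = 9 * (Real.exp (2 * κ₀ * (1 + R / ℓ)) * (2 + Real.pi * Real.sqrt 3 * ℓ / (2 * κ₀)) ^ 3) * M ^ 2 := by ring
    _ ≤ 9 * ((Real.exp 1 * Real.exp (R / ℓ)) * ((2 + Real.pi * Real.sqrt 3 / (2 * κ₀)) ^ 3 * ℓ ^ 3)) * M ^ 2 :=
        mul_le_mul_of_nonneg_right (mul_le_mul_of_nonneg_left hXY (by norm_num)) hM2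
    _ = CE * Real.exp (R / ℓ) * ℓ ^ 3 * M ^ 2 := by rw [hCE]; ring

end Summit.QuantumFields.YangMills.Theorems.Prop7InterpErrorLocalLaplaceEnergy

end
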